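import Summits.HodgeConjecture.HodgeConjecture.Theorems.R90S1QuadraticCharOfNormTrivial                -- ★ (this seat) `isQuadraticCharExtension_of_forall_norm_of_exists_fixed`
import Summits.HodgeConjecture.HodgeConjecture.Theorems.K2E3UnramifiedCharacterValueAtUniformizer      -- ★ `halfModulusChar_eq_one_of_mem_unitsIntegers`; brings ★ `exists_uniformizer_zpow_mul`, ★ `continuous_halfModulusChar_apply`, ★ `halfModulusChar_eq_one_of_forall_v_eq_one`
import Literature.NumberTheory.Automorphic.Liu2021.LemD1AsPrintedIndexedNonVacuityRamifiedConverse     -- ★ `valued_galAdicCompletionMap_sub_lt_one_of_ramified` (`σ_w ≡ id mod 𝔭_w`)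
import Literature.NumberTheory.Automorphic.HeisenbergChartAtNonsplitPlace                              -- ★ `valued_conjLocal_apply_of_smul_eq`, ★ `isUnit_two_localRing`
import HarnessLib

/-!
# R90 · S1 ∕ U4Keys leaf (U4f-χ₁-ram-one-d0B) — step Z5 «CONVERSION» at a RAMIFIED place: Branch B + the admissible root `χ₁(NΠ) = ‖NΠ‖^{1∕2}` (`X = 1∕q`)
# give `χ₁ = η‖·‖^{1∕2}` with `η|_{F^×} = ω_{E∕F}` — Keys §7 Thm (2) (d) [Keys1984 §7; Rogawski1990 §12.2 (2); Serre, Corps locaux V §3, XIV §2]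

Cell `hodgecm-mathlib`, SLAB R90-TF, section S1 «Ch. 12 local», crux H413 = `stmt-HodgeConjecture-24833` (lane `--supports … --as helper`), route
HCCMUnconditional; prover seat `hodgecm-mathlib-R90-C10-p05` (g0); socket of record S1#3′ = K2E3 leaf (U4f-χ₁-ram-one) ⊇ U4Keys :155 (depth 0, Branch B).  THEOREMS ONLY
(no definition ∕ instance ∕ notation ∕ named fact ∕ `sorry`); ★-only imports.  Paper: `K2/R90-C10-p05/PAPER-Z3-DepthZeroRamified.R90-C10-p05-g0.md` §2 (r01 junk-screen
SOUND; remarks R-b, R-e).  RAMIFIED twin of ★ p861418 `K2E3KeysThmTwoDepthZeroBranchBConversion.exists_eta_of_branchB_of_apply_uniformizer` (inert).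

WHAT.  `R = LocalRing L v` at a non-split RAMIFIED place (`he : e(w∣v) ≠ 1`) with `|2|_w = 1`, `σ = conjLocal`, `Π` ANY uniformiser unit of `R` (`|Π_w| = exp(−1)`; the skew one of
the paper or any other — the hypothesis below does not depend on the choice, R-b), `χ₁ : Rˣ →* ℂˣ` continuous with the letters of :155: `hdepth` (conductor ≤ 1), `hB`
(`χ₁(u·σu) = 1` on units), `hram` (`χ₁ ≠ 1` on the integral units), and THE ROOT `hroot : χ₁(σΠ·Π) = ‖σΠ·Π‖^{1∕2}` (`= halfModulusChar`; paper §2: `X := λ(NΠ)q^{−2s} = χ₁(NΠ) = q⁻¹`,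
the admissible zero of `det M = (q−1)²q⁻²X∕(1−X)² − q⁻¹`).
**`exists_eta_of_branchB_of_apply_norm_uniformizer_ramified`**: `∃ η, IsQuadraticCharExtension σ η ∧ Continuous η ∧ χ₁ = η · halfModulusChar` — the leaf's second disjunct VERBATIM.
PROOF (`η := χ₁ · ‖·‖^{−1∕2}`).  (i) `η` kills every norm `σ(y)·y`: `y = Πⁿ·u` (★ `exists_uniformizer_zpow_mul`), `σ(y)y = (σΠ·Π)ⁿ·(σu·u)`, and `χ₁ = ‖·‖^{1∕2}` on `σΠ·Π`
(`hroot`) and on `σu·u` (both `1`: `hB`, ★ `halfModulusChar_eq_one_of_forall_v_eq_one`).  (ii) `η ≠ 1` on some `σ`-FIXED unit — the ramified input: were `η = 1` on all fixed units,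
then for every integral unit `u` the fixed unit `f = u + σu = 2u·q`, `q := (1 + σu∕u)∕2` a PRINCIPAL unit because `σ_w ≡ id (mod 𝔭_w)` (★ Liu D1
`valued_galAdicCompletionMap_sub_lt_one_of_ramified`) and `|2|_w = 1`, gives `1 = η(f) = η(2)·η(u)·η(q) = χ₁(u)` (`hdepth` kills `q`, `η(2) = 1` as `2` is fixed, `‖·‖ = 1` on
units) — contradicting `hram`.  (iii) ★ `isQuadraticCharExtension_of_forall_norm_of_exists_fixed` (norm index ≤ 2).  Continuity and `χ₁ = η·‖·‖^{1∕2}` as in the inert twin.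
HONEST LABEL: HC_CM is proved only modulo the 7 printed citations (2 remaining named inputs: hLiu418 = `stmt-HodgeConjecture-24832`, h413 = `stmt-HodgeConjecture-24833`)
until rung 0 closes; count-neutral helper — the LAST algebraic step of the ramified d0B chain; the Casselman pair at a ramified place (Z2-B∕Z3∕Z4-ram) is untyped.

## References
* [Keys1984] D. Keys, *Principal series representations of special unitary groups over local fields*, Compositio Math. 51 (1984), §7 Theorem (2) (d) p. 126.
* [Rogawski1990] J. D. Rogawski, *Automorphic Representations of Unitary Groups in Three Variables*, Ann. of Math. Stud. 123 (1990), §12.2 (2) p. 173; §4.8 p. 51.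
* [Serre1979] J.-P. Serre, *Local Fields*, GTM 67 (1979), Ch. IV §1 Prop. 4 (inertia acts trivially on the residue field), Ch. V §3 Prop. 5 Cor. 3, Ch. XIV §2.
-/

set_option autoImplicit false
-- the mandated namespace has the single-problem summit's repeated segment (`HodgeConjecture.HodgeConjecture`)
set_option linter.dupNamespace false

noncomputable section

open NumberField IsDedekindDomain
open Literature.NumberTheory.Automorphic Literature.NumberTheory.Automorphic.UnitaryGroup
open Summit.HodgeConjecture.HodgeConjecture.Cruxes.H413

namespace Summit.HodgeConjecture.HodgeConjecture.R90.S1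

variable (L : Type) [Field L] [NumberField L] [IsCMField L] (v : HeightOneSpectrum (𝓞 ↥(maximalRealSubfield L)))
  (hns : ∀ w : PlacesOver L v, IsCMField.complexConj L • w.1 = w.1) (w : PlacesOver L v)

include hns in
/-- **THE CONVERSION (Keys §7 Thm (2) (d)) AT A RAMIFIED PLACE, BRANCH B.**  `v` non-split, `w ∣ v` RAMIFIED (`he`) with `|2|_w = 1`, `Π` a uniformiser unit of `E_v`, `χ₁` continuous
with `hdepth` (trivial on principal units), `hB` (`χ₁(u·σu) = 1` on units), `hram` (non-trivial on the integral units) and the root `hroot : χ₁(σΠ·Π) = ‖σΠ·Π‖^{1∕2}` (`X = q⁻¹`).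
Then `∃ η, IsQuadraticCharExtension σ η ∧ Continuous η ∧ χ₁ = η · halfModulusChar` (`η := χ₁·‖·‖^{-1∕2}` kills all norms; it is non-trivial on a σ-fixed unit because at a ramified
place `σ_w ≡ id (mod 𝔭_w)`; then the norm index ≤ 2). [cite: Keys1984, §7 Theorem (2) (d) p. 126] [cite: Rogawski1990, §12.2 (2) p. 173; §4.8 p. 51]
[cite: Serre1979, Ch. IV §1 Prop. 4; Ch. V §3 Prop. 5 Cor. 3] -/
theorem exists_eta_of_branchB_of_apply_norm_uniformizer_ramified (hw : IsCMField.complexConj L • w.1 = w.1)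
    (he : v.asIdeal.ramificationIdx' w.1.asIdeal ≠ 1) (h2w : Valued.v (2 : w.1.adicCompletion L) = 1)
    (piU : (LocalRing L v)ˣ) (hpiU : ∀ w' : PlacesOver L v, Valued.v ((piU : LocalRing L v) w') = WithZero.exp (-1 : ℤ))
    (χ₁ : (LocalRing L v)ˣ →* ℂˣ) (h₁ : Continuous (fun x => ((χ₁ x : ℂˣ) : ℂ)))
    (hdepth : ∀ u : (LocalRing L v)ˣ, (∀ w' : PlacesOver L v, Valued.v (((u : LocalRing L v) w') - 1) < 1) → χ₁ u = 1)
    (hB : ∀ u : (LocalRing L v)ˣ, (∀ w' : PlacesOver L v, Valued.v ((u : LocalRing L v) w') = 1) →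
      χ₁ (u * Units.map (conjLocal L (IsCMField.complexConj L) v : LocalRing L v →* LocalRing L v) u) = 1)
    (hram : ¬ ∀ u ∈ (Submonoid.pi Set.univ (fun w' : PlacesOver L v => (w'.1.adicCompletionIntegers L).toSubring.toSubmonoid)).units, χ₁ u = 1)
    (hroot : χ₁ (Units.map (conjLocal L (IsCMField.complexConj L) v : LocalRing L v →* LocalRing L v) piU * piU) =
      halfModulusChar (LocalRing L v) (Units.map (conjLocal L (IsCMField.complexConj L) v : LocalRing L v →* LocalRing L v) piU * piU)) :
    ∃ η : (LocalRing L v)ˣ →* ℂˣ, IsQuadraticCharExtension (conjLocal L (IsCMField.complexConj L) v) η ∧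
      Continuous (fun x => ((η x : ℂˣ) : ℂ)) ∧ χ₁ = η * halfModulusChar (LocalRing L v) := by
  classical
  haveI : Subsingleton (PlacesOver L v) :=
    PlacesOver.subsingleton_of_smul_eq (IsCMField.complexConj L) (IsCMField.complexConj_ne_one L) w hw
  haveI : Algebra.IsQuadraticExtension ↥(maximalRealSubfield L) L := IsCMField.isQuadraticExtension L
  set η : (LocalRing L v)ˣ →* ℂˣ := χ₁ * (halfModulusChar (LocalRing L v))⁻¹ with hηdef
  have hηapp : ∀ x, η x = χ₁ x * (halfModulusChar (LocalRing L v) x)⁻¹ := fun x => by rw [hηdef, MonoidHom.mul_apply, MonoidHom.inv_apply]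
  have hcomp : ∀ y : LocalRing L v, conjLocal L (IsCMField.complexConj L) v y w = galAdicCompletionMap (L := L) (IsCMField.complexConj L) hw (y w) :=
    fun y => conjLocal_apply_eq_of_smul_eq (IsCMField.complexConj L) (IsCMField.complexConj_ne_one L) v w hw y
  -- the unit-integer currency
  have hmodU : ∀ u : (LocalRing L v)ˣ, (∀ w' : PlacesOver L v, Valued.v ((u : LocalRing L v) w') = 1) → halfModulusChar (LocalRing L v) u = 1 :=
    fun u hu => halfModulusChar_eq_one_of_forall_v_eq_one L v u hu
  have hσU : ∀ u : (LocalRing L v)ˣ, (∀ w' : PlacesOver L v, Valued.v ((u : LocalRing L v) w') = 1) →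
      ∀ w' : PlacesOver L v, Valued.v ((Units.map (conjLocal L (IsCMField.complexConj L) v : LocalRing L v →* LocalRing L v) u : LocalRing L v) w') = 1 := by
    intro u hu w'
    rw [Units.coe_map, MonoidHom.coe_coe, valued_conjLocal_apply_of_smul_eq L v w' (hns w') (u : LocalRing L v)]
    exact hu w'
  -- (i) `η` kills every norm `σ(y)·y`
  have key : ∀ (A B : (LocalRing L v)ˣ) (n : ℤ), χ₁ A = halfModulusChar (LocalRing L v) A → χ₁ B = halfModulusChar (LocalRing L v) B → η (A ^ n * B) = 1 := by
    intro A B n hA hB'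
    rw [hηapp, map_mul, map_zpow, map_mul, map_zpow, hA, hB', mul_inv_cancel]
  have hN : ∀ y : (LocalRing L v)ˣ, η (Units.map (conjLocal L (IsCMField.complexConj L) v : LocalRing L v →* LocalRing L v) y * y) = 1 := by
    intro y
    obtain ⟨n, u, hu, hy, -⟩ := K2E3NonUnitaryCharacterDichotomy.exists_uniformizer_zpow_mul L v hns piU hpiU y
    have hu1 : ∀ w' : PlacesOver L v, Valued.v ((u : LocalRing L v) w') = 1 := (F0P3cStCharTSTorusCompactPart.mem_unitsIntegers_iff L v u).1 hu
    have hNu1 : ∀ w' : PlacesOver L v,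
        Valued.v (((Units.map (conjLocal L (IsCMField.complexConj L) v : LocalRing L v →* LocalRing L v) u * u : (LocalRing L v)ˣ) : LocalRing L v) w') = 1 := by
      intro w'
      rw [Units.val_mul, Pi.mul_apply, map_mul, hσU u hu1 w', hu1 w', mul_one]
    have hχNu : χ₁ (Units.map (conjLocal L (IsCMField.complexConj L) v : LocalRing L v →* LocalRing L v) u * u) =
        halfModulusChar (LocalRing L v) (Units.map (conjLocal L (IsCMField.complexConj L) v : LocalRing L v →* LocalRing L v) u * u) := by
      rw [hmodU _ hNu1, mul_comm]; exact hB u hu1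
    have hfact : Units.map (conjLocal L (IsCMField.complexConj L) v : LocalRing L v →* LocalRing L v) y * y =
        (Units.map (conjLocal L (IsCMField.complexConj L) v : LocalRing L v →* LocalRing L v) piU * piU) ^ n *
          (Units.map (conjLocal L (IsCMField.complexConj L) v : LocalRing L v →* LocalRing L v) u * u) := by
      rw [hy, map_mul, map_zpow, mul_mul_mul_comm, ← mul_zpow]
    rw [hfact]
    exact key _ _ n hroot hχNu
  -- (ii) `η` is non-trivial on some `σ`-fixed unit (ramified: `σ_w ≡ id mod 𝔭_w`)
  have hx : ∃ x₀ : (LocalRing L v)ˣ, conjLocal L (IsCMField.complexConj L) v (x₀ : LocalRing L v) = x₀ ∧ η x₀ ≠ 1 := by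
    by_contra H
    push Not at H
    apply hram
    intro u hu
    have hu1 : ∀ w' : PlacesOver L v, Valued.v ((u : LocalRing L v) w') = 1 := (F0P3cStCharTSTorusCompactPart.mem_unitsIntegers_iff L v u).1 hu
    have huw0 : (u : LocalRing L v) w ≠ 0 := fun h0 => by
      have := hu1 w; rw [h0, map_zero] at this; exact zero_ne_one this
    -- `σ_w u_w − u_w ∈ 𝔭_w`
    have hsub : Valued.v (galAdicCompletionMap (L := L) (IsCMField.complexConj L) hw ((u : LocalRing L v) w) - (u : LocalRing L v) w) < 1 :=
      Liu2021.LemD1IndexedNonVacuityRamifiedConverse.valued_galAdicCompletionMap_sub_lt_one_of_ramified L (IsCMField.complexConj L) v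
        (IsCMField.complexConj_ne_one L) w hw he _ (le_of_eq (hu1 w))
    -- the units `2`, `f = u + σu`, `q = f·u⁻¹·2⁻¹`
    set twoU : (LocalRing L v)ˣ := (isUnit_two_localRing L v).unit with htwoU
    have htwo : (twoU : LocalRing L v) = 2 := (isUnit_two_localRing L v).unit_spec
    have hfw : ((u : LocalRing L v) + conjLocal L (IsCMField.complexConj L) v (u : LocalRing L v)) w =
        2 * (u : LocalRing L v) w + (galAdicCompletionMap (L := L) (IsCMField.complexConj L) hw ((u : LocalRing L v) w) - (u : LocalRing L v) w) := by
      rw [Pi.add_apply, hcomp]; ring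
    have hvf : Valued.v (((u : LocalRing L v) + conjLocal L (IsCMField.complexConj L) v (u : LocalRing L v)) w) = 1 := by
      rw [hfw, Valuation.map_add_eq_of_lt_left]
      · rw [map_mul, h2w, hu1 w, one_mul]
      · rw [map_mul, h2w, hu1 w, one_mul]; exact hsub
    have hf0 : (u : LocalRing L v) + conjLocal L (IsCMField.complexConj L) v (u : LocalRing L v) ≠ 0 := fun h0 => by
      have := hvf; rw [h0, Pi.zero_apply, map_zero] at this; exact zero_ne_one this
    have hfU := (F0P3cStCharTSLocalRingNormDictionary.isUnit_iff_ne_zero_localRing L v w hw _).2 hf0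
    set fU : (LocalRing L v)ˣ := hfU.unit with hfUdef
    have hf : (fU : LocalRing L v) = (u : LocalRing L v) + conjLocal L (IsCMField.complexConj L) v (u : LocalRing L v) := hfU.unit_spec
    set q : (LocalRing L v)ˣ := fU * u⁻¹ * twoU⁻¹ with hqdef
    -- `q` is a principal unit
    have hq : ∀ w' : PlacesOver L v, Valued.v (((q : LocalRing L v) w') - 1) < 1 := by
      intro w'
      obtain rfl : w' = w := Subsingleton.elim _ _
      have h2w0 : (2 : w'.1.adicCompletion L) ≠ 0 := fun h0 => by rw [h0, map_zero] at h2w; exact zero_ne_one h2w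
      have hqw : (q : LocalRing L v) w' =
          ((u : LocalRing L v) w' + galAdicCompletionMap (L := L) (IsCMField.complexConj L) hw ((u : LocalRing L v) w')) * ((u : LocalRing L v) w')⁻¹ * 2⁻¹ := by
        rw [hqdef, Units.val_mul, Units.val_mul, Units.val_inv_eq_inv_val, Units.val_inv_eq_inv_val, Pi.mul_apply, Pi.mul_apply, Pi.inv_apply, Pi.inv_apply,
          hf, htwo, Pi.add_apply, hcomp, Pi.ofNat_apply]
      have hq1 : (q : LocalRing L v) w' - 1 =
          (galAdicCompletionMap (L := L) (IsCMField.complexConj L) hw ((u : LocalRing L v) w') - (u : LocalRing L v) w') * (((u : LocalRing L v) w')⁻¹ * 2⁻¹) := by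
        rw [hqw]; field_simp; ring
      rw [hq1, map_mul, map_mul, map_inv₀, map_inv₀, hu1 w', h2w, inv_one, mul_one, mul_one]
      exact hsub
    have hq1' : ∀ w' : PlacesOver L v, Valued.v ((q : LocalRing L v) w') = 1 := by
      intro w'
      have e : (q : LocalRing L v) w' = 1 + ((q : LocalRing L v) w' - 1) := by ring
      rw [e]
      exact Valuation.map_one_add_of_lt _ (hq w')
    -- `σ` fixes `f` and `2`
    have hfix_f : conjLocal L (IsCMField.complexConj L) v (fU : LocalRing L v) = fU := by
      rw [hf, map_add, conjLocal_conjLocal_cm L v, add_comm]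
    have hfix_2 : conjLocal L (IsCMField.complexConj L) v (twoU : LocalRing L v) = twoU := by rw [htwo, map_ofNat]
    have hηf : η fU = 1 := H fU hfix_f
    have hη2 : η twoU = 1 := H twoU hfix_2
    have hηq : η q = 1 := by rw [hηapp, hdepth q hq, hmodU q hq1', inv_one, mul_one]
    have hηu : η u = 1 := by
      have e := hηq
      rw [hqdef, map_mul, map_mul, map_inv, map_inv, hηf, hη2, one_mul, inv_one, mul_one] at e
      exact inv_eq_one.1 e
    have e := hηapp u
    rw [hηu, hmodU u hu1, inv_one, mul_one] at e
    exact e.symm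
  refine ⟨η, isQuadraticCharExtension_of_forall_norm_of_exists_fixed L v w hw η hN hx, ?_, ?_⟩
  · have hcont : Continuous fun x : (LocalRing L v)ˣ => ((χ₁ x : ℂˣ) : ℂ) * (((halfModulusChar (LocalRing L v) x : ℂˣ) : ℂ))⁻¹ :=
      h₁.mul ((continuous_halfModulusChar_apply L v).inv₀ fun x => Units.ne_zero _)
    refine hcont.congr fun x => ?_
    rw [hηapp, Units.val_mul, Units.val_inv_eq_inv_val]
  · exact MonoidHom.ext fun x => by rw [MonoidHom.mul_apply, hηapp, inv_mul_cancel_right]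

end Summit.HodgeConjecture.HodgeConjecture.R90.S1

end
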